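import Literature.NumberTheory.EllipticCurves.ThreeIsogeny
import HarnessLib

/-!
# The function `g = (y + ax + 3b)/x` on `y² = x³ − 3(ax + b)²`: a cube root of the descent value
# `α̂ ∘ φ`, on which the kernel point acts by `ω` (Cohen–Pazuki 2009, §1, `D = −3`: `Ker α = Im φ̂`)

Topic `NumberTheory/EllipticCurves`. Point-level algebra (no Galois theory, no cohomology) behind the
`3`-isogeny descent with kernel `μ₃`, generalising the tree's `MordellCurveThreeDescentKernel`
§"Point-level algebra" (`MordellDescent.gFunW (e) = (y + 3e)/x` on `y² = x³ − 3c²`, the case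
`a = 0`) to Cohen–Pazuki's curves [CohenPazuki2009, §1.2]

  `E : y² = x³ + D(ax + b)²` with `D = −3`, kernel point `T = (0, b√D) = (0, bθ)`, `θ² = −3`,

read over any field `F ∋ θ, a, b` as the tree's Vélu pair `IsVeluThreePair (aθ) (bθ) W W'`
(`W = threeTorsionModel (aθ) (bθ) : y² = x³ + (aθ·x + bθ)² = x³ − 3(ax + b)²`, file `ThreeIsogeny`,
with its `3`-isogeny `φ = (X, Y)` of kernel `{O, ±T}`). Cohen–Pazuki's isogenous curve is
`Ê : Y² = X³ + D̂(âX + b̂)²` with `D̂ = −3D = 9`, `â = a`, `b̂ = (27b − 4a³D)/9 = 3b + 4a³/3`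
(Definition 1.3), i.e. `Y² = X³ + (3aX + 4a³ + 9b)²` — the tree's `threeTorsionModel (3a) (4a³ + 9b)`,
which is Vélu's codomain `W'` translated by `4a²` (`X_Ê = X − 4a²`; Definition 1.3: «the map `φ` from
`E` to `Ê`», whose `x`-coordinate `(x³ + 4D((a²/3)x² + abx + b²))/x²` is Vélu's `X` minus `4a²`).
On `Ê` the descent map of the DUAL side is `α̂(X, Y) = Y − (3aX + 4a³ + 9b)` (Definition 1.3 with
`√D̂ = 3`; tree `ThreeTorsionDescent.descent`), and Proposition 1.4 (2) asserts `Ker α̂ = Im φ`. The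
function-theoretic content of that assertion is formalized here:

* `CPMuDescent.gFun a b : W(F) → F`, `(x, y) ↦ (y + ax + 3b)/x` (`O ↦ 0`; `±T ↦ ·/0 = 0`).
* **`gFun_pow_three`**: off the kernel, `g_{a,b}(P)³ = Y(φP) + 3a·(X(φP) − 4a²) + (4a³ + 9b)` — `g` is a
  CUBE ROOT of the conjugate descent value `Y + (3aX_Ê + 4a³ + 9b)` of `φ(P) ∈ Ê`; replacing
  `(a, b, θ)` by `(−a, −b, −θ)` (the same pair: `(−a)(−θ) = aθ`) gives `g_{−a,−b}³ = α̂(φ P)` itself.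
* `gFun_mul_gFun_neg`: `g_{a,b} · g_{−a,−b} = X(φP) − 4a² = X_Ê(φ P)`.
* **`gFun_add_T`**: `g_{a,b}(P + T) = ((θ − 1)/2) · g_{a,b}(P)` — translation by the kernel point
  multiplies `g` by the primitive cube root of unity `ω = (θ − 1)/2`; iterated in `gFun_add_nsmul_T`.
* `gFun_neg`, `gFun_ne_zero_or` (`g_{a,b}(P)` and `g_{−a,−b}(P)` do not both vanish off the kernel).

These are the identities through which the kernel theorem («`[C_u] = 0` in `H¹(K, Ê… )` iff `u` is a
descent value», sequel files) is read off, exactly as `gFunW_pow_three` / `gFunW_add_T` serve the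
Mordell case. All identities are certified by `linear_combination`.

## References

* [CohenPazuki2009] H. Cohen, F. Pazuki, *Elementary 3-descent with a 3-isogeny*, Acta Arith. 140
  (2009) 369–404, §1.2, Definition 1.3, Proposition 1.4.
* [SilvermanAEC2009] J. H. Silverman, *The Arithmetic of Elliptic Curves*, 2nd ed., X.4.9,
  Exercise 10.1 (the Kummer pairing via functions with divisor `3(T) − 3(O)`).
* Template in the tree: `Literature.NumberTheory.EllipticCurves.MordellCurveThreeDescentKernel`
  (`gFunW`, `gFunW_pow_three`, `gFunW_add_T`).

## Design

Theorems and one `def` (`gFun`), in the new namespace `Literature.NumberTheory.EllipticCurves.CPMuDescent`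
(Cohen–Pazuki `μ₃`-descent). Field-level throughout (`F` any field, `θ ∈ F` with `θ² = −3`), so
that the same algebra serves `K̄`-points and the points over completions. `open scoped Classical`
supplies `DecidableEq F` for Mathlib's chord–tangent law.
-/

noncomputable section

open scoped Classical

open WeierstrassCurve

universe u

namespace Literature.NumberTheory.EllipticCurves

namespace CPMuDescent

variable {F : Type u} [Field F] {W W' : WeierstrassCurve F} {a b θ : F}

/-! ## The Vélu pair `(aθ, bθ)`: equation and isogeny in `θ`-free form -/

/-- For the Vélu pair with parameters `(aθ, bθ)`, `θ² = −3`, the equation of `W` reads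
`y² = x³ − 3(ax + b)²` (Cohen–Pazuki's `y² = x³ + D(ax + b)²`, `D = −3`).
[cite: CohenPazuki2009, §1.2] -/
theorem equation_iff' (hV : IsVeluThreePair (a * θ) (b * θ) W W') (hθ : θ ^ 2 = -3) (x y : F) :
    W.toAffine.Equation x y ↔ y ^ 2 = x ^ 3 - 3 * (a * x + b) ^ 2 := by
  rw [hV.equation_iff]
  constructor
  · intro h; linear_combination h + (b ^ 2 + 2 * x * a * b + x ^ 2 * a ^ 2) * hθ
  · intro h; linear_combination h - (b ^ 2 + 2 * x * a * b + x ^ 2 * a ^ 2) * hθ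

/-- A nonsingular point satisfies `y² = x³ − 3(ax + b)²`. [cite: CohenPazuki2009, §1.2] -/
theorem eq_of_nonsingular (hV : IsVeluThreePair (a * θ) (b * θ) W W') (hθ : θ ^ 2 = -3) {x y : F}
    (h : W.toAffine.Nonsingular x y) : y ^ 2 = x ^ 3 - 3 * (a * x + b) ^ 2 :=
  (equation_iff' hV hθ x y).mp h.left

/-- The `x`-coordinate of the `3`-isogeny: `X(x) = (x³ + 4msx + 4s²)/x² = (x³ − 12abx − 12b²)/x²`.
[cite: CohenPazuki2009, Definition 1.3] -/
theorem X_eq' (hV : IsVeluThreePair (a * θ) (b * θ) W W') (hθ : θ ^ 2 = -3) (x : F) :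
    hV.X x = (x ^ 3 - 12 * a * b * x - 12 * b ^ 2) / x ^ 2 := by
  unfold IsVeluThreePair.X
  congr 1
  linear_combination (4 * b ^ 2 + 4 * x * a * b) * hθ

/-- The `y`-coordinate of the `3`-isogeny: `Y(x, y) = y(x³ − 4msx − 8s²)/x³ = y(x³ + 12abx + 24b²)/x³`.
[cite: CohenPazuki2009, Definition 1.3] -/
theorem Y_eq' (hV : IsVeluThreePair (a * θ) (b * θ) W W') (hθ : θ ^ 2 = -3) (x y : F) :
    hV.Y x y = y * (x ^ 3 + 12 * a * b * x + 24 * b ^ 2) / x ^ 3 := by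
  unfold IsVeluThreePair.Y
  congr 1
  linear_combination (-8 * y * b ^ 2 - 4 * x * y * a * b) * hθ

/-- `4(aθ)³ − 27 bθ = −3θ(4a³ + 9b)`, so the non-degeneracy `4m³ ≠ 27s` of the Vélu pair reads
`4a³ + 9b ≠ 0` — Cohen–Pazuki's `b̂ = 3b + 4a³/3 ≠ 0`. [cite: CohenPazuki2009, Definition 1.3] -/
theorem four_mul_pow_three_add_ne (hV : IsVeluThreePair (a * θ) (b * θ) W W') (hθ : θ ^ 2 = -3) :
    4 * a ^ 3 + 9 * b ≠ 0 := by
  intro h0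
  apply hV.disc_ne
  linear_combination (-3 * θ) * h0 + (4 * θ * a ^ 3) * hθ

/-- `b ≠ 0` (as `s = bθ ≠ 0`). [cite: CohenPazuki2009, §1.2] -/
theorem b_ne (hV : IsVeluThreePair (a * θ) (b * θ) W W') : b ≠ 0 := fun h0 =>
  hV.s_ne (by rw [h0, zero_mul])

/-- `θ ≠ 0` (as `s = bθ ≠ 0`). [cite: CohenPazuki2009, §1.2] -/
theorem theta_ne (hV : IsVeluThreePair (a * θ) (b * θ) W W') : θ ≠ 0 := fun h0 =>
  hV.s_ne (by rw [h0, mul_zero])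

/-! ## The function `g_{a,b} = (y + ax + 3b)/x` -/

/-- **The function `g_{a,b} = (y + ax + 3b)/x`** on the points of `W` (value `0` at `O` and, by
`x/0 = 0`, at `±T`): a cube root of the (conjugate) descent value of `φ(P)` on which translation by
`T` acts through `ω` — the function realising Cohen–Pazuki's `Ker α̂ = Im φ`.
[cite: CohenPazuki2009, Proposition 1.4 (2)] -/
def gFun (a b : F) : W.toAffine.Point → F
  | .zero => 0
  | .some x y _ => (y + a * x + 3 * b) / x

/-- `g_{a,b}` at an affine point. [cite: CohenPazuki2009, Proposition 1.4 (2)] -/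
@[simp] theorem gFun_some (a b : F) {x y : F} (h : W.toAffine.Nonsingular x y) :
    gFun a b (Affine.Point.some x y h) = (y + a * x + 3 * b) / x := rfl

/-- `g_{a,b}(O) = 0`. [cite: CohenPazuki2009, Proposition 1.4 (2)] -/
@[simp] theorem gFun_zero (a b : F) : gFun a b (0 : W.toAffine.Point) = 0 := rfl

/-- **`g_{a,b}³ = Y(φP) + 3a·(X(φP) − 4a²) + (4a³ + 9b)`** off the kernel: the identity
`(y + ax + 3b)³ = y(x³ + 12abx + 24b²) + 3ax(x³ − 12abx − 12b²) + (9b − 8a³)x³` on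
`y² = x³ − 3(ax + b)²`. With `(a, b, θ) ↦ (−a, −b, −θ)`: `g_{−a,−b}³ = Y − (3a(X − 4a²) + 4a³ + 9b)`, the
descent value `α̂(φ P)` on `Ê`. [cite: CohenPazuki2009, Proposition 1.4 (2)] -/
theorem gFun_pow_three (hV : IsVeluThreePair (a * θ) (b * θ) W W') (hθ : θ ^ 2 = -3)
    {x y : F} (h : W.toAffine.Nonsingular x y) (hx : x ≠ 0) :
    gFun a b (Affine.Point.some x y h) ^ 3 =
      hV.Y x y + 3 * a * (hV.X x - 4 * a ^ 2) + (4 * a ^ 3 + 9 * b) := by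
  have hE := eq_of_nonsingular hV hθ h
  have hx2 : x ^ 2 ≠ 0 := pow_ne_zero 2 hx
  have hx3 : x ^ 3 ≠ 0 := pow_ne_zero 3 hx
  rw [gFun_some, X_eq' hV hθ, Y_eq' hV hθ, div_pow, div_eq_iff hx3]
  field_simp
  linear_combination (9 * b + y + 3 * x * a) * hE

/-- `g_{a,b} · g_{−a,−b} = X(φP) − 4a²` off the kernel: `(y + ax + 3b)(y − ax − 3b) = x²(X − 4a²)`
(the `x`-coordinate of `φ(P)` on Cohen–Pazuki's model `Ê`). [cite: CohenPazuki2009, Definition 1.3] -/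
theorem gFun_mul_gFun_neg (hV : IsVeluThreePair (a * θ) (b * θ) W W') (hθ : θ ^ 2 = -3)
    {x y : F} (h : W.toAffine.Nonsingular x y) (hx : x ≠ 0) :
    gFun a b (Affine.Point.some x y h) * gFun (-a) (-b) (Affine.Point.some x y h) =
      hV.X x - 4 * a ^ 2 := by
  have hE := eq_of_nonsingular hV hθ h
  have hx2 : x ^ 2 ≠ 0 := pow_ne_zero 2 hx
  rw [gFun_some, gFun_some, X_eq' hV hθ, div_mul_div_comm, ← pow_two, div_sub' hx2,
    div_eq_div_iff hx2 hx2]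
  linear_combination x ^ 2 * hE

/-- `g_{a,b}(−P) = −g_{−a,−b}(P)`. [cite: CohenPazuki2009, Proposition 1.4 (2)] -/
theorem gFun_neg (hV : IsVeluThreePair (a * θ) (b * θ) W W') (P : W.toAffine.Point) :
    gFun a b (-P) = -gFun (-a) (-b) P := by
  rcases P with _ | ⟨x, y, h⟩
  · rw [← Affine.Point.zero_def, neg_zero, gFun_zero, gFun_zero, neg_zero]
  · rw [Affine.Point.neg_some, gFun_some, gFun_some, hV.negY_eq, ← neg_div]
    congr 1
    ring

/-! ## Translation by `T` multiplies `g` by `ω = (θ − 1)/2` -/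

variable [CharZero F]

/-- Off the kernel, `g_{a,b}(P)` and `g_{−a,−b}(P)` are not both zero: else `y = 0` and
`ax + 3b = 0`, and the equation forces `4a³ + 9b = 0`. [cite: CohenPazuki2009, Proposition 1.4 (2)] -/
theorem gFun_ne_zero_or (hV : IsVeluThreePair (a * θ) (b * θ) W W') (hθ : θ ^ 2 = -3)
    {x y : F} (h : W.toAffine.Nonsingular x y) (hx : x ≠ 0) :
    gFun a b (Affine.Point.some x y h) ≠ 0 ∨ gFun (-a) (-b) (Affine.Point.some x y h) ≠ 0 := by
  by_contra hcon
  rw [not_or, not_not, not_not, gFun_some, gFun_some, div_eq_zero_iff, div_eq_zero_iff] at hcon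
  obtain ⟨h1, h2⟩ := hcon
  have e1 : y + a * x + 3 * b = 0 := h1.resolve_right hx
  have e2 : y + -a * x + 3 * -b = 0 := h2.resolve_right hx
  have hy : y = 0 := by linear_combination (e1 + e2) / 2
  have hax : a * x = -(3 * b) := by linear_combination (e1 - e2) / 2
  have hE := eq_of_nonsingular hV hθ h
  have hb := b_ne hV
  have hd := four_mul_pow_three_add_ne hV hθ
  -- `x³ = 12 b²` and `a x = −3b`: `a³ x³ = −27 b³ = 12 a³ b²`, so `b² (4a³ + 9b) = 0`
  have hx3 : x ^ 3 = 12 * b ^ 2 := by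
    have : y ^ 2 = x ^ 3 - 3 * (a * x + b) ^ 2 := hE
    rw [hy, hax] at this
    linear_combination -this
  have key : b ^ 2 * (4 * a ^ 3 + 9 * b) = 0 := by
    have e3 : (a * x) ^ 3 = a ^ 3 * x ^ 3 := by ring
    rw [hax, hx3] at e3
    linear_combination (-1 / 3 : F) * e3
  rcases mul_eq_zero.mp key with h0 | h0
  · exact hb (pow_eq_zero_iff (two_ne_zero) |>.mp h0)
  · exact hd h0


/-- **Translation by `T = (0, bθ)` multiplies `g_{a,b}` by the cube root of unity `(θ − 1)/2`**:
`g_{a,b}(P + T) = ((θ − 1)/2) · g_{a,b}(P)` for every point `P` of `W` (on the kernel `{O, ±T}` both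
sides vanish). The computation: `T + (x, y) = (L² − (aθ)² − x, −L(L² − (aθ)² − x) − bθ)`, `L = (y − bθ)/x`
(chord through `T`, `IsVeluThreePair.T_add_some`). [cite: CohenPazuki2009, Proposition 1.4 (2)] -/
theorem gFun_add_T (hV : IsVeluThreePair (a * θ) (b * θ) W W') (hθ : θ ^ 2 = -3)
    (P : W.toAffine.Point) :
    gFun a b (P + hV.T) = (θ - 1) / 2 * gFun a b P := by
  have hs0 : b * θ ≠ 0 := hV.s_ne
  rcases P with _ | ⟨x, y, hxy⟩
  · rw [← Affine.Point.zero_def, zero_add, gFun_zero, mul_zero, IsVeluThreePair.T, gFun_some, div_zero]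
  · by_cases hx : x = 0
    · -- `P = ±T`, `P + T ∈ {−T, O}`: both sides vanish
      have h0 : gFun a b (Affine.Point.some x y hxy) = 0 := by rw [gFun_some, hx, div_zero]
      rw [h0, mul_zero]
      rcases hV.some_eq_T_or hxy hx with hP | hP <;> rw [hP]
      · rw [hV.T_add_T, hV.neg_T, gFun_some, div_zero]
      · rw [neg_add_cancel, gFun_zero]
    · obtain ⟨hQ, hadd⟩ := hV.T_add_some hxy hx
      rw [add_comm, hadd, gFun_some, gFun_some]
      set L := (b * θ - y) / (0 - x) with hL
      have hE := eq_of_nonsingular hV hθ hxy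
      have hLx : L * x = y - b * θ := by
        rw [hL]; field_simp; ring
      -- `x₃ · x² = (Lx)² − (aθ)²x² − x³`; `x₃ ≠ 0` since `T + P ∉ {±T}` for `P ∉ {O, T}` … directly:
      have hX3ne : L ^ 2 - (a * θ) ^ 2 - 0 - x ≠ 0 := by
        intro h0
        rcases hV.some_eq_T_or hQ h0 with hh | hh
        · have h3 := hadd.trans hh
          exact Affine.Point.some_ne_zero _ (add_eq_left.mp h3)
        · have h3 := hadd.trans hh
          have hP' : Affine.Point.some x y hxy = hV.T := by
            have : Affine.Point.some x y hxy = -hV.T - hV.T := by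
              rw [← h3]
              abel
            rw [this, sub_eq_add_neg, ← neg_add, hV.T_add_T, neg_neg]
          rw [IsVeluThreePair.T] at hP'
          simp only [Affine.Point.some.injEq] at hP'
          exact hx hP'.1
      rw [mul_div_assoc', div_eq_div_iff hX3ne hx]
      apply mul_left_cancel₀ (pow_ne_zero 2 hx)
      have e1 : x ^ 2 * ((-(L * (L ^ 2 - (a * θ) ^ 2 - 0 - x - 0) + b * θ) + a * (L ^ 2 - (a * θ) ^ 2
          - 0 - x) + 3 * b) * x) = -(L * x) * ((L * x) ^ 2 - (a * θ) ^ 2 * x ^ 2 - x ^ 3)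
          + a * x * ((L * x) ^ 2 - (a * θ) ^ 2 * x ^ 2 - x ^ 3) + (-(b * θ) + 3 * b) * x ^ 3 := by ring
      have e2 : x ^ 2 * ((θ - 1) / 2 * (y + a * x + 3 * b) * (L ^ 2 - (a * θ) ^ 2 - 0 - x)) =
          (θ - 1) / 2 * (y + a * x + 3 * b) * ((L * x) ^ 2 - (a * θ) ^ 2 * x ^ 2 - x ^ 3) := by ring
      rw [e1, e2, hLx]
      linear_combination ((3 / 2) * b + (1 / 2) * b * θ + b * θ ^ 2 + (-1 / 2) * y + (-1 / 2) * y * θ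
          + (3 / 2) * x * a + (-1 / 2) * x * a * θ) * hE
        + ((-3 / 2) * b ^ 3 + (-1 / 2) * b ^ 3 * θ + (1 / 2) * y * b ^ 2 + (-1 / 2) * y * b ^ 2 * θ
          + (-9 / 2) * x * a * b ^ 2 + (-1 / 2) * x * a * b ^ 2 * θ + x * y * a * b
          + (-9 / 2) * x ^ 2 * a ^ 2 * b + (1 / 2) * x ^ 2 * a ^ 2 * b * θ + (1 / 2) * x ^ 2 * y * a ^ 2
          + (1 / 2) * x ^ 2 * y * a ^ 2 * θ + x ^ 3 * b + (-3 / 2) * x ^ 3 * a ^ 3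
          + (1 / 2) * x ^ 3 * a ^ 3 * θ) * hθ

/-- Iterating `gFun_add_T`: `g_{a,b}(P + kT) = ((θ − 1)/2)^k g_{a,b}(P)`. [cite: CohenPazuki2009, Proposition 1.4 (2)] -/
theorem gFun_add_nsmul_T (hV : IsVeluThreePair (a * θ) (b * θ) W W') (hθ : θ ^ 2 = -3)
    (P : W.toAffine.Point) (k : ℕ) :
    gFun a b (P + k • hV.T) = ((θ - 1) / 2) ^ k * gFun a b P := by
  induction k with
  | zero => rw [zero_smul, add_zero, pow_zero, one_mul]
  | succ k ih => rw [succ_nsmul, ← add_assoc, gFun_add_T hV hθ, ih, pow_succ]; ring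

/-- `((θ − 1)/2)³ = 1`: the multiplier is a cube root of unity. [cite: CohenPazuki2009, §1.2] -/
theorem omega_pow_three' (hθ : θ ^ 2 = -3) : ((θ - 1) / 2 : F) ^ 3 = 1 := by
  rw [div_pow, div_eq_one_iff_eq (by norm_num)]
  linear_combination (θ - 3) * hθ

omit [CharZero F] in
/-- The same pair with the opposite square root: `IsVeluThreePair ((−a)(−θ)) ((−b)(−θ)) W W'`, so that
every statement of this file applies to `(−a, −b, −θ)`, exchanging `g_{a,b}` and `g_{−a,−b}` and `ω`
with `ω² = (−θ − 1)/2`. [cite: CohenPazuki2009, §1.2] -/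
theorem pair_neg (hV : IsVeluThreePair (a * θ) (b * θ) W W') :
    IsVeluThreePair (-a * -θ) (-b * -θ) W W' := by
  rwa [neg_mul_neg, neg_mul_neg]

omit [CharZero F] in
/-- `(−θ)² = −3`. [cite: CohenPazuki2009, §1.2] -/
theorem neg_theta_sq (hθ : θ ^ 2 = -3) : (-θ) ^ 2 = -3 := by rw [neg_sq, hθ]

omit [CharZero F] in
/-- The kernel point of the negated pair is the same point `T = (0, bθ)`. [cite: CohenPazuki2009, §1.2] -/
theorem pair_neg_T (hV : IsVeluThreePair (a * θ) (b * θ) W W') : (pair_neg hV).T = hV.T := by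
  simp only [IsVeluThreePair.T]
  congr 1
  ring

/-- Consequently **`g_{−a,−b}(P + T) = ((−θ − 1)/2) · g_{−a,−b}(P) = ω² g_{−a,−b}(P)`**.
[cite: CohenPazuki2009, Proposition 1.4 (2)] -/
theorem gFun_neg_add_T (hV : IsVeluThreePair (a * θ) (b * θ) W W') (hθ : θ ^ 2 = -3)
    (P : W.toAffine.Point) :
    gFun (-a) (-b) (P + hV.T) = (-θ - 1) / 2 * gFun (-a) (-b) P := by
  rw [← pair_neg_T hV]
  exact gFun_add_T (pair_neg hV) (neg_theta_sq hθ) P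

/-- Iterated: `g_{−a,−b}(P + kT) = ((−θ − 1)/2)^k g_{−a,−b}(P)`. [cite: CohenPazuki2009, Proposition 1.4 (2)] -/
theorem gFun_neg_add_nsmul_T (hV : IsVeluThreePair (a * θ) (b * θ) W W') (hθ : θ ^ 2 = -3)
    (P : W.toAffine.Point) (k : ℕ) :
    gFun (-a) (-b) (P + k • hV.T) = ((-θ - 1) / 2) ^ k * gFun (-a) (-b) P := by
  rw [← pair_neg_T hV]
  exact gFun_add_nsmul_T (pair_neg hV) (neg_theta_sq hθ) P k

/-- `g_{−a,−b}³ = Y(φP) − 3a(X(φP) − 4a²) − (4a³ + 9b)`: **the descent value `α̂(φ P)` on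
Cohen–Pazuki's `Ê : Y² = X³ + (3aX_Ê + 4a³ + 9b)²`, `X_Ê = X − 4a²`, is the cube `g_{−a,−b}(P)³`.**
[cite: CohenPazuki2009, Proposition 1.4 (2)] -/
theorem gFun_neg_pow_three (hV : IsVeluThreePair (a * θ) (b * θ) W W') (hθ : θ ^ 2 = -3)
    {x y : F} (h : W.toAffine.Nonsingular x y) (hx : x ≠ 0) :
    gFun (-a) (-b) (Affine.Point.some x y h) ^ 3 =
      hV.Y x y - 3 * a * (hV.X x - 4 * a ^ 2) - (4 * a ^ 3 + 9 * b) := by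
  have e := gFun_pow_three (pair_neg hV) (neg_theta_sq hθ) h hx
  rw [e]
  -- `X`, `Y` of the negated pair are the same functions
  simp only [IsVeluThreePair.X, IsVeluThreePair.Y]
  ring

end CPMuDescent

end Literature.NumberTheory.EllipticCurves

end
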